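import Summits.BirchSwinnertonDyer.BirchSwinnertonDyer.Theses.PrintCf2
import Summits.BirchSwinnertonDyer.BirchSwinnertonDyer.Theorems.PrintCf2RamifiedOffTYZSelmerRankOneSixOfFacts
import HarnessLib

/-!
# Route `PrintCf2`, aside item `RamifiedSelmerEightSixOfFactsPlus` (the `n ≡ 6 (mod 8)` minimal-Selmer door) — CLOSED BY NAME
# (cell `bsd-print-cf2`, LEAD of crux 20509 g10, line `offtyz-v7`)

The planner's aside DOOR (route rev 46) «the minimal-Selmer case of the congruent number problem at `p = 2` for square-free
`n ≡ 6 (mod 8)` in the GENUS REGIME (every block `d ≡ 6 (mod 8)` of `n` that is `n` itself or has cofactor `n/d ≡ 1 (mod 8)` with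
`#Sel₂(E_{n/d}) = 4` has ODD genus class number `g(d) = #2Cl(ℚ(√−d))`), modulo the two printed TYZ facts
(`tyz_cmPointRingClassFrobeniusFourData ∧ thm11_parity_of_scriptL`)» is VERBATIM the `OfFacts` theorem of the LEAD g9
`MoverAssembly.selmerEight_mod_eight_six_bsdp_two_of_facts` (`Theorems/PrintCf2RamifiedOffTYZSelmerRankOneSixOfFacts.lean`, p717468; the chain
(★)₆ p707948, the even mover assembly p708847/p710930, the intrinsic genus form p712053, the displays p715776, the conductor-4 Frobenius display
p710393).  This file records the closure (even twin of the odd door `RamifiedSelmerEightOddOfFactsPlus`, item 24145, p702385).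
BSD is not proved by any of this; the item closed is a conditional door (its own antecedent names the two prints); the deep regime
(`g(d)` even on a relevant block) and the `s = 3` jump-one class (C⁺, item 23431) are untouched by it.

References: [cite: TianYuanZhang2017, Thm. 1.1, Prop. 3.2 (2), §3]; [cite: Smith2016CongruentDensity, Thm. 2.2 row 6];
[cite: HeathBrown1994SelmerCongruentII, Appendix (Monsky)]; [cite: Miller2011LMS, Def. 1.1].
-/

noncomputable section

open Literature.NumberTheory.EllipticCurves Literature.NumberTheory.EllipticCurves.TianYuanZhang2017

-- the summit-side convention `Summit.<Summit>.<Problem>.Theorems.<decl>_proof` repeats the problem name (single-problem summit)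
set_option linter.dupNamespace false

namespace Summit.BirchSwinnertonDyer.BirchSwinnertonDyer.Theorems

/-- **Item `PrintCf2.RamifiedSelmerEightSixOfFactsPlus`, PROVED** (by name: the LEAD g9's
`MoverAssembly.selmerEight_mod_eight_six_bsdp_two_of_facts`): granted `tyz_cmPointRingClassFrobeniusFourData ∧ thm11_parity_of_scriptL`,
every square-free `n ≡ 6 (mod 8)` with `#Sel₂(E_n) = 8` whose blocks `d ≡ 6 (mod 8)` (with `d = n`, or `n/d ≡ 1 (mod 8)` and
`#Sel₂(E_{n/d}) = 4`) have odd genus class number has `ord_{s=1} L(E_n, s) = rank E_n(ℚ) = 1`, `Ш(E_n)[2^∞] = 0` and `BSD(E_n, 2)`.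
[cite: TianYuanZhang2017, Thm. 1.1, Prop. 3.2 (2) and §3] [cite: Smith2016CongruentDensity, Thm. 2.2] [cite: Miller2011LMS, Def. 1.1] -/
theorem ramifiedSelmerEightSixOfFactsPlus_proof :
    Summit.BirchSwinnertonDyer.BirchSwinnertonDyer.Theses.PrintCf2.RamifiedSelmerEightSixOfFactsPlus :=
  Summit.BirchSwinnertonDyer.PrintCf2.MoverAssembly.selmerEight_mod_eight_six_bsdp_two_of_facts

end Summit.BirchSwinnertonDyer.BirchSwinnertonDyer.Theorems

end
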